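import Summits.Ventures.PercRepro.RankLevelSetFrameLarge

/-!
# PercRepro — EVERY LEVEL OF C-025 IS A FINITE PROBLEM MODULO THE LEVEL BELOW (night-1, gen 3)

`proofs/NIGHT-1-C025-induction.md` §14.9. Two more consequences of local sparsity on the `e`-free core:

* **`exists_N_core_fixed_rank`** — at a FIXED pair `(p, q)` with `q + 2 ≤ p`, the core (rank `p`, every element with an
  `e`-free partition) satisfies `Φ(p, q)·#U ≤ #Y` as soon as `|E| ≥ N(p, q)`: `#U ≤ C(n, q)·2^{2^q − 1}` while
  `#Y ≥ C(n, p − 1) − #{r ≤ q}` and `C(n, p − 1)/C(n, q) = C(n − q, p − 1 − q)/C(p − 1, q) → ∞` (`p − 1 > q`);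
* **`exists_finite_cells_level_succ`** — hence, with Theorem C∞ (`exists_P_c025_all_corank`) bounding the rank and the
  wrapper `rls_succ_all` reducing everything to the simple coloop-free `e`-free core: for every `q ≥ 2` there are `P`, `N`
  such that C-025 at level `q + 1` follows from C-025 at level `q` and from the core cells with `q + 3 ≤ p < P` and
  `|E| < N` — FINITELY MANY MATROIDS up to isomorphism. Each level of the conjecture is thus decidable by a finite
  census modulo the level below (the census is infeasible: `P(q)` is existential here, astronomical in closed form);
* **`ncard_ground_add_one_le_two_pow_of_free`** — THE `e`-FREE CORE OF RANK `p` HAS AT MOST `2^p − 1` ELEMENTS (local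
  sparsity applied to `E` itself), so the core at a fixed rank is a finite family outright, and
  **`exists_finite_cells_level_succ'`** states the reduction with the cells EXPLICIT in `|E|`: rank `q + 3 ≤ p < P` on at
  most `2^p − 1` elements.
Axioms: standard.
-/

open scoped Matroid

namespace PercRepro

/-- `C(n, j) ≤ C(n, q)` for `j ≤ q ≤ n/2` (Pascal's row is increasing up to the middle). -/
theorem choose_le_choose_of_le_half (n : ℕ) : ∀ q, q ≤ n / 2 → ∀ j, j ≤ q → n.choose j ≤ n.choose q := by
  intro q
  induction q with
  | zero => intro _ j hj; rw [Nat.le_zero.1 hj]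
  | succ q ih =>
    intro hq j hj
    rcases Nat.lt_or_ge j (q + 1) with h | h
    · calc n.choose j ≤ n.choose q := ih (by omega) j (by omega)
        _ ≤ n.choose (q + 1) := Nat.choose_le_succ_of_lt_half_left (by omega)
    · rw [show j = q + 1 by omega]

/-- `Σ_{j ≤ q} C(n, j) ≤ (q + 1) · C(n, q)` for `2q ≤ n`. -/
theorem sum_choose_le_mul_choose (n q : ℕ) (h : 2 * q ≤ n) :
    ∑ j ∈ Finset.range (q + 1), n.choose j ≤ (q + 1) * n.choose q := by
  calc ∑ j ∈ Finset.range (q + 1), n.choose j ≤ ∑ _j ∈ Finset.range (q + 1), n.choose q := by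
        apply Finset.sum_le_sum
        intro j hj
        rw [Finset.mem_range] at hj
        exact choose_le_choose_of_le_half n q (by omega) j (by omega)
    _ = (q + 1) * n.choose q := by rw [Finset.sum_const, Finset.card_range, smul_eq_mul]

namespace ThmN

open Set

variable {α : Type}

/-- **The sets of rank `≤ q` of the `e`-free core number at most `(Σ_{j ≤ q} C(n, j)) · 2^{2^q − 1}`** (the rank-`j`
sets for each `j ≤ q`, `ncard_eRk_eq_le_choose_mul`). -/
theorem ncard_eRk_le_le_sum_choose_mul (M : Matroid α) [M.Finite]
    (hfree : ∀ e ∈ M.E, ∃ A ⊆ M.E \ {e}, e ∉ M.closure A ∧ e ∉ M.closure ((M.E \ {e}) \ A)) (q : ℕ) :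
    {X : Set α | X ⊆ M.E ∧ M.eRk X ≤ q}.ncard ≤
      (∑ j ∈ Finset.range (q + 1), M.ground_finite.toFinset.card.choose j) * 2 ^ (2 ^ q - 1) := by
  have hfin : ∀ P : Set α → Prop, {X : Set α | X ⊆ M.E ∧ P X}.Finite :=
    fun P => M.ground_finite.finite_subsets.subset (fun X hX => hX.1)
  induction q with
  | zero =>
    rw [Finset.sum_range_one]
    have hsub : {X : Set α | X ⊆ M.E ∧ M.eRk X ≤ ((0 : ℕ) : ℕ∞)} ⊆
        {X : Set α | X ⊆ M.E ∧ M.eRk X = ((0 : ℕ) : ℕ∞)} := by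
      intro X hX
      exact ⟨hX.1, by simpa using hX.2⟩
    calc {X : Set α | X ⊆ M.E ∧ M.eRk X ≤ ((0 : ℕ) : ℕ∞)}.ncard
        ≤ {X : Set α | X ⊆ M.E ∧ M.eRk X = ((0 : ℕ) : ℕ∞)}.ncard := Set.ncard_le_ncard hsub (hfin _)
      _ ≤ _ := ncard_eRk_eq_le_choose_mul M hfree 0
  | succ q ih =>
    rw [Finset.sum_range_succ, add_mul]
    have hsplit : {X : Set α | X ⊆ M.E ∧ M.eRk X ≤ ((q + 1 : ℕ) : ℕ∞)} ⊆
        {X : Set α | X ⊆ M.E ∧ M.eRk X ≤ (q : ℕ∞)} ∪ {X : Set α | X ⊆ M.E ∧ M.eRk X = ((q + 1 : ℕ) : ℕ∞)} := by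
      intro X hX
      rcases le_or_gt (M.eRk X) q with h | h
      · exact Or.inl ⟨hX.1, h⟩
      · refine Or.inr ⟨hX.1, le_antisymm hX.2 ?_⟩
        rw [Nat.cast_succ]
        exact Order.add_one_le_of_lt h
    have hmono : 2 ^ (2 ^ q - 1) ≤ 2 ^ (2 ^ (q + 1) - 1) :=
      Nat.pow_le_pow_right (by norm_num) (by have := Nat.one_le_two_pow (n := q); rw [pow_succ]; omega)
    calc {X : Set α | X ⊆ M.E ∧ M.eRk X ≤ ((q + 1 : ℕ) : ℕ∞)}.ncard
        ≤ ({X : Set α | X ⊆ M.E ∧ M.eRk X ≤ (q : ℕ∞)} ∪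
            {X : Set α | X ⊆ M.E ∧ M.eRk X = ((q + 1 : ℕ) : ℕ∞)}).ncard :=
          Set.ncard_le_ncard hsplit ((hfin _).union (hfin _))
      _ ≤ {X : Set α | X ⊆ M.E ∧ M.eRk X ≤ (q : ℕ∞)}.ncard +
            {X : Set α | X ⊆ M.E ∧ M.eRk X = ((q + 1 : ℕ) : ℕ∞)}.ncard := Set.ncard_union_le _ _
      _ ≤ (∑ j ∈ Finset.range (q + 1), M.ground_finite.toFinset.card.choose j) * 2 ^ (2 ^ q - 1) +
            M.ground_finite.toFinset.card.choose (q + 1) * 2 ^ (2 ^ (q + 1) - 1) :=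
          add_le_add ih (ncard_eRk_eq_le_choose_mul M hfree (q + 1))
      _ ≤ (∑ j ∈ Finset.range (q + 1), M.ground_finite.toFinset.card.choose j) * 2 ^ (2 ^ (q + 1) - 1) +
            M.ground_finite.toFinset.card.choose (q + 1) * 2 ^ (2 ^ (q + 1) - 1) := by gcongr

/-- **`C(n, p − 1) ≤ #Y(p, q) + #{r ≤ q}`**: a `(p − 1)`-subset of `E` has rank `< p`, so it lies in `Y` unless its
rank is `≤ q`. -/
theorem choose_le_midCount_add (M : Matroid α) [M.Finite] {p : ℕ} (q : ℕ) (hp : 1 ≤ p) :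
    M.ground_finite.toFinset.card.choose (p - 1) ≤
      Matroid.midCount M p q + {X : Set α | X ⊆ M.E ∧ M.eRk X ≤ q}.ncard := by
  have hE : (M.ground_finite.toFinset : Set α) = M.E := Set.Finite.coe_toFinset _
  have hfin : ∀ P : Set α → Prop, {X : Set α | X ⊆ M.E ∧ P X}.Finite :=
    fun P => M.ground_finite.finite_subsets.subset (fun X hX => hX.1)
  rw [← ncard_subsets_ncard_eq M.ground_finite.toFinset (p - 1)]
  unfold Matroid.midCount
  have hsub : {X : Set α | X ⊆ (M.ground_finite.toFinset : Set α) ∧ X.ncard = p - 1} ⊆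
      {A : Set α | A ⊆ M.E ∧ (q : ℕ∞) < M.eRk A ∧ M.eRk A < (p : ℕ∞)} ∪
        {X : Set α | X ⊆ M.E ∧ M.eRk X ≤ q} := by
    intro X hX
    have hXE : X ⊆ M.E := by rw [← hE]; exact hX.1
    have hXfin : X.Finite := M.ground_finite.subset hXE
    rcases le_or_gt (M.eRk X) q with h | h
    · exact Or.inr ⟨hXE, h⟩
    · refine Or.inl ⟨hXE, h, ?_⟩
      calc M.eRk X ≤ X.encard := M.eRk_le_encard X
        _ = ((p - 1 : ℕ) : ℕ∞) := by rw [← hXfin.cast_ncard_eq, hX.2]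
        _ < (p : ℕ∞) := by exact_mod_cast (show p - 1 < p by omega)
  calc {X : Set α | X ⊆ (M.ground_finite.toFinset : Set α) ∧ X.ncard = p - 1}.ncard
      ≤ ({A : Set α | A ⊆ M.E ∧ (q : ℕ∞) < M.eRk A ∧ M.eRk A < (p : ℕ∞)} ∪
          {X : Set α | X ⊆ M.E ∧ M.eRk X ≤ q}).ncard :=
        Set.ncard_le_ncard hsub ((hfin _).union (hfin _))
    _ ≤ _ := Set.ncard_union_le _ _

/-- **THE CORE AT A FIXED PAIR `(p, q)` AND LARGE CORANK, EXPLICIT**: for `q + 2 ≤ p`, every finite matroid (of ANY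
rank) with `|E| ≥ q + a + a!·c·C(p − 1, q) + 2p` (`a = p − 1 − q`, `c = 2^{p+q}·2^{2^q − 1} + (q + 1)·2^{2^q − 1}`) in
which every element admits an `e`-free partition satisfies `Φ(p, q)·#U(p, q) ≤ #Y(p, q)` (the rank plays no role:
`#U ≤ #{r = q}` and `#Y ≥ C(n, p − 1) − #{r ≤ q}` hold regardless). -/
theorem core_fixed_rank_of_le (p q : ℕ) (hqp : q + 2 ≤ p) {α : Type} (M : Matroid α) [M.Finite]
    (hN : q + (p - 1 - q) + (p - 1 - q).factorial *
      (2 ^ (p + q) * 2 ^ (2 ^ q - 1) + (q + 1) * 2 ^ (2 ^ q - 1)) * (p - 1).choose q + 2 * p ≤ M.E.ncard)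
    (hfree : ∀ e ∈ M.E, ∃ A ⊆ M.E \ {e}, e ∉ M.closure A ∧ e ∉ M.closure ((M.E \ {e}) \ A)) : RLS M p q := by
  classical
  set K := 2 ^ (2 ^ q - 1) with hK
  set a := p - 1 - q with ha
  set c := 2 ^ (p + q) * K + (q + 1) * K with hc
  set n := M.E.ncard with hn_def
  have hEcard : M.ground_finite.toFinset.card = n := by
    rw [hn_def, Set.ncard_eq_toFinset_card _ M.ground_finite]
  -- (U)
  have hU : Matroid.topCount M p q ≤ n.choose q * K := by
    calc Matroid.topCount M p q ≤ Matroid.levelCount M q := Matroid.topCount_le_levelCount_bot p q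
      _ = {X : Set α | X ⊆ M.E ∧ M.eRk X = q}.ncard := rfl
      _ ≤ n.choose q * K := by rw [← hEcard]; exact ncard_eRk_eq_le_choose_mul M hfree q
  -- (Y)
  have hY := choose_le_midCount_add M q (by omega : 1 ≤ p)
  have hA := ncard_eRk_le_le_sum_choose_mul M hfree q
  rw [hEcard] at hY hA
  have hA' : {X : Set α | X ⊆ M.E ∧ M.eRk X ≤ q}.ncard ≤ (q + 1) * n.choose q * K := by
    calc {X : Set α | X ⊆ M.E ∧ M.eRk X ≤ q}.ncard ≤ (∑ j ∈ Finset.range (q + 1), n.choose j) * K := hA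
      _ ≤ ((q + 1) * n.choose q) * K := Nat.mul_le_mul_right _ (sum_choose_le_mul_choose n q (by omega))
  -- the key binomial inequality `c · C(n, q) ≤ C(n, p − 1)`
  have hkey : c * n.choose q ≤ n.choose (p - 1) := by
    have ha1 : 1 ≤ a := by omega
    have h1 : a.factorial * c * (p - 1).choose q ≤ n - q + 1 - a := by omega
    have h2 : n - q + 1 - a ≤ (n - q + 1 - a) ^ a := Nat.le_self_pow (by omega) _
    have h3 : (n - q + 1 - a) ^ a ≤ (n - q).descFactorial a := Nat.pow_sub_le_descFactorial (n - q) a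
    rw [Nat.descFactorial_eq_factorial_mul_choose] at h3
    have h4 : a.factorial * (c * (p - 1).choose q) ≤ a.factorial * (n - q).choose a := by
      rw [← mul_assoc]; exact (h1.trans h2).trans h3
    have h5 : c * (p - 1).choose q ≤ (n - q).choose a := Nat.le_of_mul_le_mul_left h4 (Nat.factorial_pos a)
    have hid : n.choose (p - 1) * (p - 1).choose q = n.choose q * (n - q).choose a := by
      rw [ha, Nat.choose_mul (by omega)]
    have hpos : 0 < (p - 1).choose q := Nat.choose_pos (by omega)
    have h6 : c * n.choose q * (p - 1).choose q ≤ n.choose (p - 1) * (p - 1).choose q := by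
      calc c * n.choose q * (p - 1).choose q = n.choose q * (c * (p - 1).choose q) := by ring
        _ ≤ n.choose q * (n - q).choose a := Nat.mul_le_mul_left _ h5
        _ = n.choose (p - 1) * (p - 1).choose q := hid.symm
    exact Nat.le_of_mul_le_mul_right h6 hpos
  -- assemble in `ℚ`
  rw [RLS_iff]
  have hΦ := phiK_le_two_pow_div p q
  have hc1 : (1 : ℚ) ≤ ((p + q).choose p : ℚ) := by exact_mod_cast Nat.choose_pos (Nat.le_add_right p q)
  have hΦ' : phiK p q ≤ (2 ^ (p + q) : ℚ) := hΦ.trans (div_le_self (by positivity) hc1)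
  have hU0 : (0 : ℚ) ≤ (Matroid.topCount M p q : ℚ) := by positivity
  have hUq : (Matroid.topCount M p q : ℚ) ≤ (n.choose q : ℚ) * (K : ℚ) := by exact_mod_cast hU
  have hYq : (n.choose (p - 1) : ℚ) ≤ (Matroid.midCount M p q : ℚ) + ((q : ℚ) + 1) * (n.choose q : ℚ) * (K : ℚ) := by
    have := hY.trans (Nat.add_le_add_left hA' _)
    exact_mod_cast this
  have hkeyq : (c : ℚ) * (n.choose q : ℚ) ≤ (n.choose (p - 1) : ℚ) := by exact_mod_cast hkey
  have hcq : (c : ℚ) = 2 ^ (p + q) * (K : ℚ) + ((q : ℚ) + 1) * (K : ℚ) := by rw [hc]; push_cast; ring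
  rw [hcq] at hkeyq
  calc phiK p q * (Matroid.topCount M p q : ℚ) ≤ (2 ^ (p + q) : ℚ) * ((n.choose q : ℚ) * (K : ℚ)) :=
        mul_le_mul hΦ' hUq hU0 (by positivity)
    _ ≤ (Matroid.midCount M p q : ℚ) := by nlinarith [hkeyq, hYq]

/-- **THE CORE AT A FIXED PAIR `(p, q)` AND LARGE CORANK**: for `q + 2 ≤ p` there is `N` such that every finite
matroid of rank `p` with `|E| ≥ N` in which every element admits an `e`-free partition satisfies
`Φ(p, q)·#U(p, q) ≤ #Y(p, q)` (`core_fixed_rank_of_le` with its explicit `N`). -/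
theorem exists_N_core_fixed_rank (p q : ℕ) (hqp : q + 2 ≤ p) :
    ∃ N : ℕ, ∀ {α : Type} (M : Matroid α) [M.Finite], N ≤ M.E.ncard → M.eRank = (p : ℕ∞) →
      (∀ e ∈ M.E, ∃ A ⊆ M.E \ {e}, e ∉ M.closure A ∧ e ∉ M.closure ((M.E \ {e}) \ A)) → RLS M p q :=
  ⟨_, fun M _ hN _hR hfree => core_fixed_rank_of_le p q hqp M hN hfree⟩

/-- **EVERY LEVEL IS A FINITE PROBLEM MODULO THE LEVEL BELOW**: for every `q ≥ 2` there are `P` and `N` such that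
C-025 at level `q + 1` for every finite matroid and every `p ≥ q + 3` follows from C-025 at level `q` (all `p ≥ q + 2`)
together with the simple, coloop-free, `e`-free core cells of rank `q + 3 ≤ p < P` on fewer than `N` elements —
finitely many matroids up to isomorphism. -/
theorem exists_finite_cells_level_succ (q : ℕ) (hq : 2 ≤ q) :
    ∃ P N : ℕ, ∀ {α : Type},
      (∀ (M : Matroid α) [M.Finite] (p : ℕ), q + 2 ≤ p → RLS M p q) →
      (∀ (M : Matroid α) [M.Finite] (p : ℕ), q + 3 ≤ p → p < P → M.E.ncard < N →
        (∀ e ∈ M.E, ∀ f ∈ M.E, e ≠ f → M.eRk {e, f} = 2) → M.eRank = (p : ℕ∞) → (∀ e, ¬ M.IsColoop e) →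
        (∀ e ∈ M.E, ∃ A ⊆ M.E \ {e}, e ∉ M.closure A ∧ e ∉ M.closure ((M.E \ {e}) \ A)) → RLS M p (q + 1)) →
      ∀ (M : Matroid α) [M.Finite] (p : ℕ), q + 3 ≤ p → RLS M p (q + 1) := by
  classical
  obtain ⟨P, hP⟩ := exists_P_c025_all_corank (q + 1) (by omega)
  let Nf : ℕ → ℕ := fun p =>
    if h : q + 3 ≤ p then Classical.choose (exists_N_core_fixed_rank p (q + 1) (by omega)) else 0
  have hNf : ∀ p, q + 3 ≤ p → ∀ {α : Type} (M : Matroid α) [M.Finite], Nf p ≤ M.E.ncard →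
      M.eRank = (p : ℕ∞) →
      (∀ e ∈ M.E, ∃ A ⊆ M.E \ {e}, e ∉ M.closure A ∧ e ∉ M.closure ((M.E \ {e}) \ A)) → RLS M p (q + 1) := by
    intro p hp
    simp only [Nf, dif_pos hp]
    exact Classical.choose_spec (exists_N_core_fixed_rank p (q + 1) (by omega))
  refine ⟨P, (Finset.range P).sup Nf, ?_⟩
  intro α hprev hcells
  refine rls_succ_all q hprev ?_
  intro M _ p hp hs hR hc hfree
  rcases Nat.lt_or_ge p P with hpP | hpP
  · rcases Nat.lt_or_ge M.E.ncard ((Finset.range P).sup Nf) with hn | hn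
    · exact hcells M p hp hpP hn hs hR hc hfree
    · have hle : Nf p ≤ (Finset.range P).sup Nf := Finset.le_sup (Finset.mem_range.2 hpP)
      exact hNf p hp M (hle.trans hn) hR hfree
  · exact hP M p hpP (by omega)

/-- **THE CORE IS FINE BEYOND A CORANK `D(q)` INDEPENDENT OF `p`**: for every `q ≥ 2` there is `D` such that every
finite matroid of rank `p ≥ q + 2` with `|E| > p + D` in which every element admits an `e`-free partition satisfies
`Φ(p, q)·#U(p, q) ≤ #Y(p, q)` (large `p`: `exists_P_core_all_corank`; the finitely many small `p`:
`exists_N_core_fixed_rank`). -/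
theorem exists_D_core_uniform (q : ℕ) (hq : 2 ≤ q) :
    ∃ D : ℕ, ∀ {α : Type} (M : Matroid α) [M.Finite] (p : ℕ), q + 2 ≤ p → M.eRank = (p : ℕ∞) →
      p + D < M.E.ncard →
      (∀ e ∈ M.E, ∃ A ⊆ M.E \ {e}, e ∉ M.closure A ∧ e ∉ M.closure ((M.E \ {e}) \ A)) → RLS M p q := by
  classical
  obtain ⟨P, hP⟩ := exists_P_core_all_corank q hq
  let Nf : ℕ → ℕ := fun p =>
    if h : q + 2 ≤ p then Classical.choose (exists_N_core_fixed_rank p q h) else 0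
  have hNf : ∀ p, q + 2 ≤ p → ∀ {α : Type} (M : Matroid α) [M.Finite], Nf p ≤ M.E.ncard →
      M.eRank = (p : ℕ∞) →
      (∀ e ∈ M.E, ∃ A ⊆ M.E \ {e}, e ∉ M.closure A ∧ e ∉ M.closure ((M.E \ {e}) \ A)) → RLS M p q := by
    intro p hp
    simp only [Nf, dif_pos hp]
    exact Classical.choose_spec (exists_N_core_fixed_rank p q hp)
  refine ⟨max (2 * q + 2 ^ q) ((Finset.range P).sup Nf), ?_⟩
  intro α M _ p hp hR hbig hfree
  rcases Nat.lt_or_ge p P with hpP | hpP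
  · have hle : Nf p ≤ (Finset.range P).sup Nf := Finset.le_sup (Finset.mem_range.2 hpP)
    refine hNf p hp M ?_ hR hfree
    have := le_max_right (2 * q + 2 ^ q) ((Finset.range P).sup Nf)
    omega
  · refine hP M p hpP hR ?_ hfree
    have := le_max_left (2 * q + 2 ^ q) ((Finset.range P).sup Nf)
    omega

/-- **LEVEL `q + 1` FROM LEVEL `q` AND THE BOUNDED-CORANK CORE**: for every `q ≥ 2` there is `D` such that C-025 at
level `q + 1` (every finite matroid, every `p ≥ q + 3`) follows from level `q` (all `p ≥ q + 2`) together with the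
simple, coloop-free, `e`-free core of corank `≤ D` at level `q + 1` — for every rank `p`. (Theorem C covers that
core for `p` large; what is left of the crux at each level is the bounded-corank core at small `p`.) -/
theorem exists_D_level_succ_of_bounded_core (q : ℕ) (hq : 2 ≤ q) :
    ∃ D : ℕ, ∀ {α : Type},
      (∀ (M : Matroid α) [M.Finite] (p : ℕ), q + 2 ≤ p → RLS M p q) →
      (∀ (M : Matroid α) [M.Finite] (p : ℕ), q + 3 ≤ p → M.E.ncard ≤ p + D →
        (∀ e ∈ M.E, ∀ f ∈ M.E, e ≠ f → M.eRk {e, f} = 2) → M.eRank = (p : ℕ∞) → (∀ e, ¬ M.IsColoop e) →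
        (∀ e ∈ M.E, ∃ A ⊆ M.E \ {e}, e ∉ M.closure A ∧ e ∉ M.closure ((M.E \ {e}) \ A)) → RLS M p (q + 1)) →
      ∀ (M : Matroid α) [M.Finite] (p : ℕ), q + 3 ≤ p → RLS M p (q + 1) := by
  obtain ⟨D, hD⟩ := exists_D_core_uniform (q + 1) (by omega)
  refine ⟨D, ?_⟩
  intro α hprev hcells
  refine rls_succ_all q hprev ?_
  intro M _ p hp hs hR hc hfree
  rcases Nat.lt_or_ge (p + D) M.E.ncard with hbig | hsmall
  · exact hD M p (by omega) hR hbig hfree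
  · exact hcells M p hp hsmall hs hR hc hfree

/-- **The `e`-free core of rank `p` has at most `2^p − 1` elements** (`ncard_add_one_le_two_pow_of_eRk_le` for
`X = E`): for every fixed rank the core is a finite family of matroids. -/
theorem ncard_ground_add_one_le_two_pow_of_free (M : Matroid α) [M.Finite] {p : ℕ} (hR : M.eRank = (p : ℕ∞))
    (hfree : ∀ e ∈ M.E, ∃ A ⊆ M.E \ {e}, e ∉ M.closure A ∧ e ∉ M.closure ((M.E \ {e}) \ A)) :
    M.E.ncard + 1 ≤ 2 ^ p := by
  refine ncard_add_one_le_two_pow_of_eRk_le M (not_isLoop_of_free M hfree) hfree p M.E subset_rfl ?_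
  rw [← M.eRank_def, hR]

/-- **LEVEL `q + 1` FROM LEVEL `q` AND EXPLICITLY FINITE CORE CELLS**: for every `q ≥ 2` there is `P` such that C-025 at
level `q + 1` (every finite matroid, every `p ≥ q + 3`) follows from level `q` together with the simple, coloop-free,
`e`-free core cells of rank `q + 3 ≤ p < P` ON AT MOST `2^p − 1` ELEMENTS (which is all of them). -/
theorem exists_finite_cells_level_succ' (q : ℕ) (hq : 2 ≤ q) :
    ∃ P : ℕ, ∀ {α : Type},
      (∀ (M : Matroid α) [M.Finite] (p : ℕ), q + 2 ≤ p → RLS M p q) →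
      (∀ (M : Matroid α) [M.Finite] (p : ℕ), q + 3 ≤ p → p < P → M.E.ncard + 1 ≤ 2 ^ p →
        (∀ e ∈ M.E, ∀ f ∈ M.E, e ≠ f → M.eRk {e, f} = 2) → M.eRank = (p : ℕ∞) → (∀ e, ¬ M.IsColoop e) →
        (∀ e ∈ M.E, ∃ A ⊆ M.E \ {e}, e ∉ M.closure A ∧ e ∉ M.closure ((M.E \ {e}) \ A)) → RLS M p (q + 1)) →
      ∀ (M : Matroid α) [M.Finite] (p : ℕ), q + 3 ≤ p → RLS M p (q + 1) := by
  obtain ⟨P, hP⟩ := exists_P_c025_all_corank (q + 1) (by omega)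
  refine ⟨P, ?_⟩
  intro α hprev hcells
  refine rls_succ_all q hprev ?_
  intro M _ p hp hs hR hc hfree
  rcases Nat.lt_or_ge p P with hpP | hpP
  · exact hcells M p hp hpP (ncard_ground_add_one_le_two_pow_of_free M hR hfree) hs hR hc hfree
  · exact hP M p hpP (by omega)

end ThmN

end PercRepro
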